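import Mathlib.Order.SymmDiff
import Mathlib.Data.Finset.SymmDiff
import Literature.Computability.Complexity.BonamiLevelK
import HarnessLib

/-!
# The algebra of low-degree functions on the cube: `deg(gh) ≤ deg g + deg h`

Degree bookkeeping for the Fourier–Walsh expansion on `{0,1}^m` (conventions of
`BooleanFourier.lean`: `cubeFourierCoeff g S = ĝ(S)`, `walsh S = χ_S`). A real function `g` has
*Fourier level at most `d`* (`IsLevelLE d g`, the hypothesis of the tree's Bonami lemma
`bonami_even_moment`) when `ĝ(S) = 0` for all `|S| > d`, i.e. `g ∈ span{χ_S : |S| ≤ d}`, i.e. `g`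
is a multilinear polynomial of degree `≤ d` in the `±1` coordinates. We prove

* `walsh_mul_walsh` — `χ_S χ_T = χ_{S ∆ T}` (O'Donnell 2014, Fact 1.4/§1.4), `cubeFourierCoeff_walsh`;
* `cubeFourierCoeff_mul` — the **convolution formula** `(gh)^(U) = ∑_S ĝ(S) ĥ(S ∆ U)`;
* finite additivity of `ĝ` (`cubeFourierCoeff_sum`; `_add/_sub/_const_mul` are in `FourierTails.lean`);
* closure of `IsLevelLE`: constants (level `0`), characters, sums, scalar multiples, and the
  **degree sub-additivity under products** `IsLevelLE.mul` (`deg(gh) ≤ deg g + deg h`,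
  O'Donnell 2014, Ex. 1.9/Prop. on multilinear degree), with `IsLevelLE.prod`, `IsLevelLE.pow`.

These are the combinatorial inputs of the transfer of Bonami's inequality to polynomials of
Gaussian (and Rademacher-sum) variables (`Literature/Probability/Distributions/GaussianHypercontractivity`).
Everything is a finite sum; no named facts.

## References

* R. O'Donnell, *Analysis of Boolean Functions*, CUP 2014, §1.2–1.4 (multilinear expansion,
  `χ_S χ_T = χ_{S∆T}`, degree), §9.1. [ODonnell2014]
-/

noncomputable section

namespace Literature.Computability.Complexity.LowDegree

open Finset Literature.Probability.RandomGraphs.LowDegree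
open scoped symmDiff

variable {m : ℕ}

/-! ### Characters -/

/-- **`χ_S · χ_T = χ_{S ∆ T}`** (the `±1` coordinates square to one). [cite: ODonnell2014, §1.4] -/
theorem walsh_mul_walsh (S T : Finset (Fin m)) (x : Fin m → Bool) :
    walsh S x * walsh T x = walsh (S ∆ T) x := by
  rw [walsh_eq_prod_ite, walsh_eq_prod_ite, walsh_eq_prod_ite, ← prod_mul_distrib]
  refine prod_congr rfl fun i _ => ?_
  by_cases hS : i ∈ S <;> by_cases hT : i ∈ T <;> simp [hS, hT, mem_symmDiff, sgn_mul_self]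

/-- The coefficients of a character: `χ̂_S(T) = [S = T]`. [cite: ODonnell2014, §1.4] -/
theorem cubeFourierCoeff_walsh (S T : Finset (Fin m)) :
    cubeFourierCoeff (walsh S) T = if S = T then 1 else 0 := by
  unfold cubeFourierCoeff
  rw [sum_walsh_mul_walsh_index]
  have h2 : (2 : ℝ) ^ m ≠ 0 := by positivity
  split_ifs
  · field_simp
  · rw [zero_div]

/-! ### Linearity of the coefficients

`cubeFourierCoeff_add`, `cubeFourierCoeff_sub`, `cubeFourierCoeff_const_mul` and
`cubeFourierCoeff_const` (for `S ≠ ∅`) are in `FourierTails.lean`; we add finite sums. -/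

/-- `(∑ᵢ gᵢ)^ = ∑ᵢ ĝᵢ`. [folklore] -/
theorem cubeFourierCoeff_sum {ι : Type*} (s : Finset ι) (g : ι → (Fin m → Bool) → ℝ) (S : Finset (Fin m)) :
    cubeFourierCoeff (fun x => ∑ i ∈ s, g i x) S = ∑ i ∈ s, cubeFourierCoeff (g i) S := by
  unfold cubeFourierCoeff
  rw [← sum_div]
  congr 1
  rw [sum_comm]
  exact sum_congr rfl fun x _ => by rw [sum_mul]

/-! ### The convolution formula for products -/

/-- **Coefficients of a product**: `(gh)^(U) = ∑_S ĝ(S) ĥ(S ∆ U)` (convolution on `(ℤ/2)^m`).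
[cite: ODonnell2014, §1.4] -/
theorem cubeFourierCoeff_mul (g h : (Fin m → Bool) → ℝ) (U : Finset (Fin m)) :
    cubeFourierCoeff (fun x => g x * h x) U = ∑ S, cubeFourierCoeff g S * cubeFourierCoeff h (S ∆ U) := by
  have h2 : (2 : ℝ) ^ m ≠ 0 := by positivity
  have e1 : ∀ x : Fin m → Bool, g x * h x * walsh U x =
      ∑ S, cubeFourierCoeff g S * (h x * walsh (S ∆ U) x) := by
    intro x
    conv_lhs => rw [← sum_cubeFourierCoeff_mul_walsh g x]
    rw [sum_mul, sum_mul]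
    refine sum_congr rfl fun S _ => ?_
    rw [← walsh_mul_walsh]; ring
  unfold cubeFourierCoeff
  simp_rw [show ∀ x : Fin m → Bool, g x * h x * walsh U x =
      ∑ S, (∑ y, g y * walsh S y) / 2 ^ m * (h x * walsh (S ∆ U) x) from e1]
  rw [sum_comm, sum_div]
  refine sum_congr rfl fun S _ => ?_
  rw [← mul_sum, mul_div_assoc]

/-! ### Functions of Fourier level at most `d` -/

/-- `g` has Fourier level at most `d`: `ĝ(S) = 0` whenever `|S| > d` (`g` is a multilinear
polynomial of degree `≤ d`; the hypothesis of `bonami_even_moment`). [cite: ODonnell2014, §1.4] -/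
def IsLevelLE (d : ℕ) (g : (Fin m → Bool) → ℝ) : Prop :=
  ∀ S : Finset (Fin m), d < S.card → cubeFourierCoeff g S = 0

/-- Unfolding `IsLevelLE`. [folklore] -/
theorem isLevelLE_iff (d : ℕ) (g : (Fin m → Bool) → ℝ) :
    IsLevelLE d g ↔ ∀ S : Finset (Fin m), d < S.card → cubeFourierCoeff g S = 0 := Iff.rfl

/-- Monotonicity in the level. [folklore] -/
theorem IsLevelLE.mono {d d' : ℕ} {g : (Fin m → Bool) → ℝ} (hg : IsLevelLE d g) (h : d ≤ d') :
    IsLevelLE d' g := fun S hS => hg S (lt_of_le_of_lt h hS)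

/-- Constants have level `0`. [cite: ODonnell2014, §1.2] -/
theorem isLevelLE_const (c : ℝ) (d : ℕ) : IsLevelLE d (fun _ : Fin m → Bool => c) := by
  intro S hS
  refine cubeFourierCoeff_const ?_
  rintro rfl
  simp at hS

/-- The zero function has every level. [folklore] -/
theorem isLevelLE_zero (d : ℕ) : IsLevelLE d (fun _ : Fin m → Bool => (0 : ℝ)) := isLevelLE_const 0 d

/-- A character `χ_S` has level `|S|`. [cite: ODonnell2014, §1.4] -/
theorem isLevelLE_walsh (S : Finset (Fin m)) {d : ℕ} (hS : S.card ≤ d) : IsLevelLE d (walsh S) := by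
  intro T hT
  rw [cubeFourierCoeff_walsh, if_neg]
  rintro rfl
  omega

/-- Sums. [folklore] -/
theorem IsLevelLE.add {d : ℕ} {g h : (Fin m → Bool) → ℝ} (hg : IsLevelLE d g) (hh : IsLevelLE d h) :
    IsLevelLE d (fun x => g x + h x) := fun S hS => by
  rw [cubeFourierCoeff_add, hg S hS, hh S hS, add_zero]

/-- Scalar multiples. [folklore] -/
theorem IsLevelLE.const_mul {d : ℕ} {g : (Fin m → Bool) → ℝ} (c : ℝ) (hg : IsLevelLE d g) :
    IsLevelLE d (fun x => c * g x) := fun S hS => by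
  rw [cubeFourierCoeff_const_mul, hg S hS, mul_zero]

/-- Negation. [folklore] -/
theorem IsLevelLE.neg {d : ℕ} {g : (Fin m → Bool) → ℝ} (hg : IsLevelLE d g) :
    IsLevelLE d (fun x => -g x) := by
  simpa using hg.const_mul (-1)

/-- Differences. [folklore] -/
theorem IsLevelLE.sub {d : ℕ} {g h : (Fin m → Bool) → ℝ} (hg : IsLevelLE d g) (hh : IsLevelLE d h) :
    IsLevelLE d (fun x => g x - h x) := fun S hS => by
  rw [cubeFourierCoeff_sub, hg S hS, hh S hS, sub_zero]

/-- Finite sums. [folklore] -/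
theorem IsLevelLE.sum {ι : Type*} {d : ℕ} (s : Finset ι) {g : ι → (Fin m → Bool) → ℝ}
    (hg : ∀ i ∈ s, IsLevelLE d (g i)) : IsLevelLE d (fun x => ∑ i ∈ s, g i x) := fun S hS => by
  rw [cubeFourierCoeff_sum]
  exact sum_eq_zero fun i hi => hg i hi S hS

/-- **Degree is sub-additive under products**: `deg(gh) ≤ deg g + deg h`. [cite: ODonnell2014, §1.4] -/
theorem IsLevelLE.mul {d₁ d₂ : ℕ} {g h : (Fin m → Bool) → ℝ} (hg : IsLevelLE d₁ g) (hh : IsLevelLE d₂ h) :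
    IsLevelLE (d₁ + d₂) (fun x => g x * h x) := by
  intro U hU
  rw [cubeFourierCoeff_mul]
  refine sum_eq_zero fun S _ => ?_
  by_cases hS : d₁ < S.card
  · rw [hg S hS, zero_mul]
  · have hle : U.card ≤ S.card + (S ∆ U).card := by
      calc U.card = (S ∆ (S ∆ U)).card := by rw [symmDiff_symmDiff_cancel_left]
        _ ≤ (S ∪ (S ∆ U)).card := card_le_card symmDiff_le_sup
        _ ≤ S.card + (S ∆ U).card := card_union_le _ _
    have h2 : d₂ < (S ∆ U).card := by omega
    rw [hh _ h2, mul_zero]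

/-- Finite products: `deg(∏ᵢ gᵢ) ≤ ∑ᵢ deg gᵢ`. [cite: ODonnell2014, §1.4] -/
theorem IsLevelLE.prod {ι : Type*} [DecidableEq ι] (s : Finset ι) {d : ι → ℕ}
    {g : ι → (Fin m → Bool) → ℝ} (hg : ∀ i ∈ s, IsLevelLE (d i) (g i)) :
    IsLevelLE (∑ i ∈ s, d i) (fun x => ∏ i ∈ s, g i x) := by
  induction s using Finset.induction_on with
  | empty => simpa using isLevelLE_const (m := m) 1 0
  | insert a s ha ih =>
    have h1 : IsLevelLE (d a) (g a) := hg a (mem_insert_self a s)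
    have h2 : IsLevelLE (∑ i ∈ s, d i) (fun x => ∏ i ∈ s, g i x) :=
      ih fun i hi => hg i (mem_insert_of_mem hi)
    have h3 := h1.mul h2
    simp only [sum_insert ha, prod_insert ha]
    exact h3

/-- Powers: `deg(g^n) ≤ n deg g`. [cite: ODonnell2014, §1.4] -/
theorem IsLevelLE.pow {d : ℕ} {g : (Fin m → Bool) → ℝ} (hg : IsLevelLE d g) (n : ℕ) :
    IsLevelLE (n * d) (fun x => g x ^ n) := by
  induction n with
  | zero => simpa using isLevelLE_const (m := m) 1 0
  | succ n ih =>
    have h := ih.mul hg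
    simp only [pow_succ]
    rw [show (n + 1) * d = n * d + d by ring]
    exact h

/-- A function of level `≤ d` satisfies Bonami's even-moment inequality (restatement of
`bonami_even_moment` with the bundled hypothesis). [cite: ODonnell2014, Thm. 9.21] -/
theorem IsLevelLE.bonami_even_moment {d : ℕ} {g : (Fin m → Bool) → ℝ} (hg : IsLevelLE d g)
    (r : ℕ) (hr : 1 ≤ r) :
    (∑ x, (g x ^ 2) ^ r) / 2 ^ m ≤ (2 * r - 1 : ℝ) ^ (r * d) * ((∑ x, g x ^ 2) / 2 ^ m) ^ r :=
  LowDegree.bonami_even_moment d g hg r hr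

end Literature.Computability.Complexity.LowDegree

end
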